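import Summits.Ventures.DiscreteObjects.Hadamard.Order334InvertingFixedTools668
import Summits.Ventures.DiscreteObjects.Hadamard.NegaPairItoQuadruple
import Summits.Ventures.DiscreteObjects.Hadamard.Order167NormalizerElementaryAbelian668
import Summits.Ventures.DiscreteObjects.Hadamard.Order167IndexTwoIto668

/-!
# H(668): an element of order 334 inverted by an automorphism WITH A FIXED ROW forces Williamson sequences of length 167
# (kernel) — part B: the theorem; the last index-2 leaf of the 167-local dictionary falls onto the classical Williamson line

Framing: lottery ticket; floor = certified bounds/negative ranges.

Cell pub-namedobj (venture DiscreteObjects), target (H), hadamard gen 23; HANDOFF-H-g22 item 2(a).  See part A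
(`Order334InvertingFixedTools668`) for the setting and the sign analysis.  Here: gen 19's negaperiodic pair read along the
FIXED row `x₀` (verbatim replay of `negaPair_of_hadamard668_signedAut_334` with `x₀` prescribed), translated by the column
offsets `c_y` (`κ' y = κ^{2c_y} y`), is reversal-symmetric with sign `(−1)^t` (part A); split along the CRT
`ℤ/668 ≃ ℤ/4 × ℤ/167` (gen 23, `NegaPairItoQuadruple`: shift class `(0, r)` gives `Σ PAF = 0`) it yields four SYMMETRIC `±1`
sequences: **`hadamard668_order334_inverting_fixed_williamsonSequences`** — Williamson sequences of length `167` exist.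
Existence level, with gen 22 (`WilliamsonSequences167Iff668`): **`hadamard668_order334_inverting_fixed_williamson`**,
**`hadamard668_order334_inverting_fixed_normalizer_index_eight`** — (∃ H(668) with an element of pair order 334 inverted by an
automorphism fixing a row) ⇒ (∃ Williamson sequences of length 167) ⇔ (∃ H(668) with `|N(⟨σ₁₆₇⟩):±⟨σ₁₆₇⟩| = 8`) ⇔ a
classical Williamson matrix of order 668; and the CONVERSE (`hadamard668_normalizer_index_eight_order334_inverting_fixed`, via
gen 22's block-preserving translate: it fixes 4 rows, commutes with `τ₁`, hence inverts `τ₁σ` of pair order 334), so that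
**`hadamard668_order334_inverting_fixed_iff_williamsonSequences`** is a KERNEL IFF.  CONSEQUENCE for the 167-local dictionary at
EXISTENCE level: on the order-334 line (= Ito's conjecture at `t = 167`, `Order334ItoTfae668`) an inverting automorphism
either fixes a row — then WILLIAMSON sequences of length 167 exist — or the whole inverting coset is fixed-point-free (gen 22's
regular Ito configuration).  STRUCTURE / DICTIONARY of a hypothetical object; all sides OPEN; no order excluded; H(668)
untouched.  Ours; no `sorry`, no definitions, default heartbeats.
-/

namespace Summit.Ventures.DiscreteObjects.Hadamard

open Finset BigOperators Matrix

open Literature.Combinatorics.Designs.GoethalsSeidel (IsHadamardMatrix)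
open Literature.Combinatorics.Designs.LegendrePairs (PAF IsPM translate PAF_translate)

variable {ι : Type*} [Fintype ι] [DecidableEq ι]

section main
variable {H : Matrix ι ι ℤ} (hH : IsHadamardMatrix H) (hι : Fintype.card ι = 668)
  {π κ π' κ' : Equiv.Perm ι} {d e d' e' : ι → ℤ} (haut : IsSignedAut H π κ d e)
  (hπ : π ^ 334 = 1) (hκ : κ ^ 334 = 1) (h2 : π ^ 2 ≠ 1 ∨ κ ^ 2 ≠ 1) (h167 : π ^ 167 ≠ 1 ∨ κ ^ 167 ≠ 1)
  (haut' : IsSignedAut H π' κ' d' e') {ν : ℕ} (hnπ : π' * π = π ^ ν * π') (hnκ : κ' * κ = κ ^ ν * κ') (hν : ν % 334 = 333)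
include hH hι haut hπ hκ h2 haut' hnπ hnκ hν

/-! ### the main theorem -/

include h167 in
/-- **An element of order 334 inverted by an automorphism with a fixed row forces Williamson sequences of length 167.** -/
theorem hadamard668_order334_inverting_fixed_williamsonSequences {x₀ : ι} (hfix : π' x₀ = x₀) :
    ∃ a b c d : ZMod 167 → ℤ, IsPM a ∧ IsPM b ∧ IsPM c ∧ IsPM d ∧ (∀ i, a (-i) = a i) ∧ (∀ i, b (-i) = b i) ∧
      (∀ i, c (-i) = c i) ∧ (∀ i, d (-i) = d i) ∧
      ∀ s : ZMod 167, s ≠ 0 → PAF a s + PAF b s + PAF c s + PAF d s = 0 := by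
  obtain ⟨hfreeR, hfreeC⟩ := hadamard668_order334_free hH hι haut hπ hκ h2 h167
  obtain ⟨-, hnegC⟩ := hadamard668_order334_nega hH hι haut hπ hκ h2 h167
  have hκ668 : κ ^ 668 = 1 := by rw [show (668 : ℕ) = 334 * 2 by norm_num, pow_mul, hκ, one_pow]
  -- the constant sign `ε = −1`
  obtain ⟨ε, hε, hχ⟩ := inverting334_chi_const hH hι haut hπ hκ h2 haut' hnπ hnκ hν hfix
  -- transversal of the two column orbits (gen 19)
  obtain ⟨T, -, hTcard, hT⟩ := exists_free_transversal κ (by norm_num : 0 < 334) _ (univ : Finset ι) le_rfl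
    (fun y _ => Finset.mem_univ _) (fun y _ => by rw [hκ, Equiv.Perm.one_apply]) (fun y _ k hk0 hk => hfreeC y k hk0 hk)
  rw [Finset.card_univ, hι] at hTcard
  have hT2 : T.card = 2 := by omega
  -- gen 19's signed cycle sequences along the FIXED row `x₀`
  let A : ι → ZMod 668 → ℤ := fun y t => cyc κ e y t.val * H x₀ ((κ ^ t.val) y)
  have hApm : ∀ y, IsPM (A y) := by
    intro y t
    rcases cyc_pm κ e haut.2.1 y t.val with h1 | h1 <;> rcases hH.1 x₀ ((κ ^ t.val) y) with h2' | h2' <;>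
      simp [A, h1, h2']
  have hAanti : ∀ y t, A y (t + 334) = -A y t := by
    intro y t
    simp only [A]
    rw [ZMod.val_add, cyc_mod_668_of_nega κ e hnegC y, pow_mod_of_pow_eq_one κ hκ668,
      show (334 : ZMod 668).val = 334 from rfl, cyc_add_334_of_nega κ e hnegC y, pow_add, hκ, mul_one]
    ring
  have hPAF : ∀ y (s : ZMod 668), 0 < s.val → s.val ≠ 334 →
      PAF (A y) s = 2 * cyc π d ((π ^ (668 - s.val)) x₀) s.val *
        ∑ m ∈ Finset.range 334, H x₀ ((κ ^ m) y) * H ((π ^ (668 - s.val)) x₀) ((κ ^ m) y) := by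
    intro y s hs0 hs334
    set r := s.val with hr
    have hrlt : r < 668 := ZMod.val_lt s
    obtain ⟨hback, -⟩ := order334_partner hπ hfreeR x₀ hs0 hrlt hs334
    set x₁ := (π ^ (668 - r)) x₀ with hx₁
    have hpt : ∀ m : ℕ, cyc κ e y m * H x₀ ((κ ^ m) y) * (cyc κ e y (m + r) * H x₀ ((κ ^ (m + r)) y)) =
        cyc π d x₁ r * (H x₀ ((κ ^ m) y) * H x₁ ((κ ^ m) y)) := by
      intro m
      have hit : H x₀ ((κ ^ (m + r)) y) = cyc π d x₁ r * cyc κ e ((κ ^ m) y) r * H x₁ ((κ ^ m) y) := by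
        rw [← hback, add_comm, pow_add, Equiv.Perm.mul_apply]
        exact signedAut_pow haut r x₁ ((κ ^ m) y)
      have hca : cyc κ e y (m + r) = cyc κ e y m * cyc κ e ((κ ^ m) y) r := cyc_add κ e y m r
      rw [hit, hca]
      have h1 := pm_mul_self (cyc_pm κ e haut.2.1 y m)
      have h2' := pm_mul_self (cyc_pm κ e haut.2.1 ((κ ^ m) y) r)
      calc cyc κ e y m * H x₀ ((κ ^ m) y) *
            (cyc κ e y m * cyc κ e ((κ ^ m) y) r * (cyc π d x₁ r * cyc κ e ((κ ^ m) y) r * H x₁ ((κ ^ m) y)))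
          = (cyc κ e y m * cyc κ e y m) * (cyc κ e ((κ ^ m) y) r * cyc κ e ((κ ^ m) y) r) *
              (cyc π d x₁ r * (H x₀ ((κ ^ m) y) * H x₁ ((κ ^ m) y))) := by ring
        _ = cyc π d x₁ r * (H x₀ ((κ ^ m) y) * H x₁ ((κ ^ m) y)) := by rw [h1, h2']; ring
    unfold PAF
    have hterm : ∀ t : ZMod 668, A y t * A y (t + s) =
        cyc κ e y t.val * H x₀ ((κ ^ t.val) y) * (cyc κ e y (t.val + r) * H x₀ ((κ ^ (t.val + r)) y)) := by
      intro t
      simp only [A]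
      rw [ZMod.val_add, cyc_mod_668_of_nega κ e hnegC y, pow_mod_of_pow_eq_one κ hκ668]
    simp only [hterm, hpt]
    rw [sum_zmod_val_eq_sum_range (fun m => cyc π d x₁ r * (H x₀ ((κ ^ m) y) * H x₁ ((κ ^ m) y))),
      ← Finset.mul_sum, show (668 : ℕ) = 334 + 334 by norm_num, Finset.sum_range_add]
    have hhalf : ∑ m ∈ Finset.range 334, H x₀ ((κ ^ (334 + m)) y) * H x₁ ((κ ^ (334 + m)) y) =
        ∑ m ∈ Finset.range 334, H x₀ ((κ ^ m) y) * H x₁ ((κ ^ m) y) := by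
      refine Finset.sum_congr rfl fun m _ => ?_
      rw [pow_add, hκ, one_mul]
    rw [hhalf]
    ring
  have hsum : ∀ s : ZMod 668, s ≠ 0 → s ≠ 334 → ∑ y ∈ T, PAF (A y) s = 0 := by
    intro s hs hs334
    have hs0 : 0 < s.val := (zmod_val_pos_of_ne_zero hs).1
    have hsv : s.val ≠ 334 := by
      intro h
      apply hs334
      have : ((s.val : ℕ) : ZMod 668) = ((334 : ℕ) : ZMod 668) := by rw [h]
      simpa using this
    obtain ⟨-, hne⟩ := order334_partner hπ hfreeR x₀ hs0 (ZMod.val_lt s) hsv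
    rw [Finset.sum_congr rfl fun y _ => hPAF y s hs0 hsv, ← Finset.mul_sum,
      ← hT (fun j => H x₀ j * H ((π ^ (668 - s.val)) x₀) j), hadamard_row_orth H hH (Ne.symm hne), mul_zero]
  -- the two columns and their orbit offsets
  let e2 : {y // y ∈ T} ≃ Fin 2 := Finset.equivFinOfCardEq hT2
  set y₁ : ι := ((e2.symm 0 : {y // y ∈ T}) : ι) with hy₁
  set y₂ : ι := ((e2.symm 1 : {y // y ∈ T}) : ι) with hy₂
  obtain ⟨c₁, hc₁, hκc₁⟩ := inverting334_col_orbit hH hι haut hπ hκ h2 haut' hnπ hnκ hν hfix y₁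
  obtain ⟨c₂, hc₂, hκc₂⟩ := inverting334_col_orbit hH hι haut hπ hκ h2 haut' hnπ hnκ hν hfix y₂
  have hεm : ε = -1 := inverting334_eps haut hκ haut' hnκ hν hnegC hH.1 hε hχ hfix hc₁ hκc₁
  rw [hεm] at hχ
  -- the translated pair `u = A y₁ (· + c₁)`, `v = A y₂ (· + c₂)`
  have hNGP : ∀ s : ZMod 668, s ≠ 0 → s ≠ 334 →
      PAF (translate (A y₁) (c₁ : ZMod 668)) s + PAF (translate (A y₂) (c₂ : ZMod 668)) s = 0 := by
    intro s hs hs334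
    rw [PAF_translate, PAF_translate]
    have h := hsum s hs hs334
    rw [← Finset.sum_coe_sort T] at h
    have hre : ∑ i : Fin 2, PAF (A (e2.symm i)) s = ∑ y : {y // y ∈ T}, PAF (A y) s :=
      Fintype.sum_equiv e2.symm _ _ (fun _ => rfl)
    rw [← hre, Fin.sum_univ_two] at h
    exact h
  have hrefl₁ : ∀ t, translate (A y₁) (c₁ : ZMod 668) (-t) = (-1) ^ t.val * translate (A y₁) (c₁ : ZMod 668) t :=
    fun t => translate_seq_reflect haut hκ haut' hnκ hν hnegC hH.1 hχ hfix hc₁ hκc₁ t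
  have hrefl₂ : ∀ t, translate (A y₂) (c₂ : ZMod 668) (-t) = (-1) ^ t.val * translate (A y₂) (c₂ : ZMod 668) t :=
    fun t => translate_seq_reflect haut hκ haut' hnκ hν hnegC hH.1 hχ hfix hc₂ hκc₂ t
  have hanti : ∀ (y : ι) (c : ℕ) (t : ZMod 668), translate (A y) (c : ZMod 668) (t + 334) = -translate (A y) (c : ZMod 668) t :=
    fun y c t => by show A y (t + 334 + c) = -A y (t + c); rw [add_right_comm, hAanti]
  have hpm : ∀ (y : ι) (c : ℕ), IsPM (translate (A y) (c : ZMod 668)) := fun y c t => hApm y _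
  -- generic names
  set u := translate (A y₁) (c₁ : ZMod 668) with hu
  set v := translate (A y₂) (c₂ : ZMod 668) with hv
  -- the CRT
  obtain ⟨f, hf334, hf0, hf3⟩ := crt668
  have hfh : f.symm (2, 0) = 334 := by rw [← hf334, f.symm_apply_apply]
  have hsplit : ∀ (w : ZMod 668 → ℤ), (∀ t, w (t + 334) = -w t) →
      ∀ k j, w (f.symm (k + 2, j)) = -w (f.symm (k, j)) := fun w hw k j => by
    rw [show ((k + 2, j) : ZMod 4 × ZMod 167) = (k, j) + (2, 0) by rw [Prod.mk_add_mk, add_zero], map_add, hfh, hw]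
  -- symmetry of the four sequences
  have hsymm0 : ∀ (w : ZMod 668 → ℤ), (∀ t, w (-t) = (-1) ^ t.val * w t) →
      ∀ j : ZMod 167, w (f.symm (0, -j)) = w (f.symm (0, j)) := fun w hw j => by
    have hneg : f.symm (0, -j) = -f.symm (0, j) := by rw [← map_neg, Prod.neg_mk, neg_zero]
    rw [hneg, hw, hf0 _ (by rw [f.apply_symm_apply]), one_mul]
  have hsymm1 : ∀ (w : ZMod 668 → ℤ), (∀ t, w (-t) = (-1) ^ t.val * w t) → (∀ t, w (t + 334) = -w t) →
      ∀ j : ZMod 167, w (f.symm (1, -j)) = w (f.symm (1, j)) := fun w hw hw' j => by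
    have hneg : f.symm (1, -j) = -f.symm (3, j) := by
      rw [← map_neg, Prod.neg_mk, show (-3 : ZMod 4) = 1 by decide]
    rw [hneg, hw, hf3 _ (by rw [f.apply_symm_apply]), show ((3 : ZMod 4), j) = ((1 : ZMod 4) + 2, j) by
      rw [show (1 : ZMod 4) + 2 = 3 by decide], hsplit w hw' 1 j]
    ring
  -- the four-square identity from the negaperiodic pair (shift class `(0, r)`)
  have hU : ∀ k j, u (f.symm (k + 2, j)) = -u (f.symm (k, j)) := hsplit u (hanti y₁ c₁)
  have hV : ∀ k j, v (f.symm (k + 2, j)) = -v (f.symm (k, j)) := hsplit v (hanti y₂ c₂)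
  have hPu : ∀ q : ZMod 4 × ZMod 167, PAF u (f.symm q) = ∑ p, u (f.symm p) * u (f.symm (p + q)) := fun q => by
    rw [paf_transport f.toAddEquiv u]
    show ∑ p, u (f.symm p) * u (f.symm (p + f (f.symm q))) = _
    rw [f.apply_symm_apply]
  have hPv : ∀ q : ZMod 4 × ZMod 167, PAF v (f.symm q) = ∑ p, v (f.symm p) * v (f.symm (p + q)) := fun q => by
    rw [paf_transport f.toAddEquiv v]
    show ∑ p, v (f.symm p) * v (f.symm (p + f (f.symm q))) = _
    rw [f.apply_symm_apply]
  have hE1 : ∀ r : ZMod 167, r ≠ 0 →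
      PAF (fun j => u (f.symm (0, j))) r + PAF (fun j => u (f.symm (1, j))) r +
        PAF (fun j => v (f.symm (0, j))) r + PAF (fun j => v (f.symm (1, j))) r = 0 := by
    intro r hr
    have hne0 : f.symm (0, r) ≠ 0 := fun h0 => by
      have h1 := congrArg f h0
      rw [f.apply_symm_apply, map_zero] at h1
      exact hr (by simpa using congrArg Prod.snd h1)
    have hne334 : f.symm (0, r) ≠ 334 := fun h0 => by
      have h1 := congrArg f h0
      rw [f.apply_symm_apply, hf334, Prod.mk.injEq] at h1
      exact absurd h1.1 (by decide)
    have h0 := hNGP (f.symm (0, r)) hne0 hne334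
    rw [hPu, hPv, sum_antiperiodic_shift0 (fun p => u (f.symm p)) hU r,
      sum_antiperiodic_shift0 (fun p => v (f.symm p)) hV r] at h0
    linarith
  exact ⟨fun j => u (f.symm (0, j)), fun j => u (f.symm (1, j)), fun j => v (f.symm (0, j)), fun j => v (f.symm (1, j)),
    fun j => hpm y₁ c₁ _, fun j => hpm y₁ c₁ _, fun j => hpm y₂ c₂ _, fun j => hpm y₂ c₂ _,
    hsymm0 u hrefl₁, hsymm1 u hrefl₁ (hanti y₁ c₁), hsymm0 v hrefl₂, hsymm1 v hrefl₂ (hanti y₂ c₂), hE1⟩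

end main

/-! ### existence level: the leaf falls onto the classical Williamson line -/

/-- **(∃ H(668) with an element of pair order 334 inverted by an automorphism fixing a row) ⇒ (∃ Williamson sequences of
length 167)**, hence (gen 22, `WilliamsonSequences167Iff668`) the `|N(⟨σ₁₆₇⟩):±⟨σ₁₆₇⟩| = 8` configuration is realised by
some H(668) and a classical Williamson matrix of order 668 exists. -/
theorem hadamard668_order334_inverting_fixed_williamson
    (hyp : ∃ (ι : Type) (_ : Fintype ι) (_ : DecidableEq ι) (H : Matrix ι ι ℤ) (π κ π' κ' : Equiv.Perm ι)
        (d e d' e' : ι → ℤ) (ν : ℕ) (x₀ : ι), Fintype.card ι = 668 ∧ IsHadamardMatrix H ∧ IsSignedAut H π κ d e ∧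
        orderOf ((π, κ) : Equiv.Perm ι × Equiv.Perm ι) = 334 ∧ IsSignedAut H π' κ' d' e' ∧
        π' * π = π ^ ν * π' ∧ κ' * κ = κ ^ ν * κ' ∧ ν % 334 = 333 ∧ π' x₀ = x₀) :
    ∃ a b c d : ZMod 167 → ℤ, IsPM a ∧ IsPM b ∧ IsPM c ∧ IsPM d ∧ (∀ i, a (-i) = a i) ∧ (∀ i, b (-i) = b i) ∧
      (∀ i, c (-i) = c i) ∧ (∀ i, d (-i) = d i) ∧
      ∀ s : ZMod 167, s ≠ 0 → PAF a s + PAF b s + PAF c s + PAF d s = 0 := by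
  obtain ⟨ι, _, _, H, π, κ, π', κ', d, e, d', e', ν, x₀, hι, hH, haut, hord, haut', hnπ, hnκ, hν, hfix⟩ := hyp
  obtain ⟨hπ, hκ, h2⟩ := pow_data_of_orderOf hord (a := 2) (by norm_num) (by norm_num)
  obtain ⟨-, -, h167⟩ := pow_data_of_orderOf hord (a := 167) (by norm_num) (by norm_num)
  exact hadamard668_order334_inverting_fixed_williamsonSequences hH hι haut hπ hκ h2 h167 haut' hnπ hnκ hν hfix

/-- **… ⇒ the classical-Williamson configuration of gen 22**: some Hadamard matrix of order `668` has `σ₁₆₇` with an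
index-`4` centraliser and an inverting automorphism (`|N(⟨σ⟩):±⟨σ⟩| = 8`). -/
theorem hadamard668_order334_inverting_fixed_normalizer_index_eight
    (hyp : ∃ (ι : Type) (_ : Fintype ι) (_ : DecidableEq ι) (H : Matrix ι ι ℤ) (π κ π' κ' : Equiv.Perm ι)
        (d e d' e' : ι → ℤ) (ν : ℕ) (x₀ : ι), Fintype.card ι = 668 ∧ IsHadamardMatrix H ∧ IsSignedAut H π κ d e ∧
        orderOf ((π, κ) : Equiv.Perm ι × Equiv.Perm ι) = 334 ∧ IsSignedAut H π' κ' d' e' ∧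
        π' * π = π ^ ν * π' ∧ κ' * κ = κ ^ ν * κ' ∧ ν % 334 = 333 ∧ π' x₀ = x₀) :
    ∃ (ι : Type) (_ : Fintype ι) (_ : DecidableEq ι) (H : Matrix ι ι ℤ) (π κ π₁ κ₁ π₂ κ₂ π' κ' : Equiv.Perm ι)
        (d e d₁ e₁ d₂ e₂ d' e' : ι → ℤ) (μ : ℕ), Fintype.card ι = 668 ∧ IsHadamardMatrix H ∧ IsSignedAut H π κ d e ∧
        π ^ 167 = 1 ∧ κ ^ 167 = 1 ∧ (π ≠ 1 ∨ κ ≠ 1) ∧ IsSignedAut H π₁ κ₁ d₁ e₁ ∧ IsSignedAut H π₂ κ₂ d₂ e₂ ∧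
        Commute π₁ π ∧ Commute κ₁ κ ∧ Commute π₂ π ∧ Commute κ₂ κ ∧ π₁ ^ 2 = 1 ∧ κ₁ ^ 2 = 1 ∧ π₂ ^ 2 = 1 ∧ κ₂ ^ 2 = 1 ∧
        (π₁ ≠ 1 ∨ κ₁ ≠ 1) ∧ (π₂ ≠ 1 ∨ κ₂ ≠ 1) ∧ (π₁ ≠ π₂ ∨ κ₁ ≠ κ₂) ∧ IsSignedAut H π' κ' d' e' ∧
        π' * π = π ^ μ * π' ∧ κ' * κ = κ ^ μ * κ' ∧ μ % 167 = 166 :=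
  hadamard668_normalizer_index_eight_iff_williamsonSequences.mpr (hadamard668_order334_inverting_fixed_williamson hyp)

/-- **Converse: the classical-Williamson configuration gives an element of order 334 inverted by a row-fixing automorphism.**
From gen 22's `|N(⟨σ⟩):±⟨σ⟩| = 8` configuration (`σ`, two centralising involutions `τ₁, τ₂`, an inverting `ρ'`): some
`V₄`-translate `ρ'' = τ_g ρ'` fixes `4` rows (`exists_blockPreserving_inverting`), commutes with `τ₁`
(`hadamard668_order167_inverting_commute_involution`), and so inverts `g = τ₁ σ` of pair order `334` with multiplier `333`. -/
theorem hadamard668_normalizer_index_eight_order334_inverting_fixed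
    (hyp : ∃ (ι : Type) (_ : Fintype ι) (_ : DecidableEq ι) (H : Matrix ι ι ℤ) (π κ π₁ κ₁ π₂ κ₂ π' κ' : Equiv.Perm ι)
        (d e d₁ e₁ d₂ e₂ d' e' : ι → ℤ) (μ : ℕ), Fintype.card ι = 668 ∧ IsHadamardMatrix H ∧ IsSignedAut H π κ d e ∧
        π ^ 167 = 1 ∧ κ ^ 167 = 1 ∧ (π ≠ 1 ∨ κ ≠ 1) ∧ IsSignedAut H π₁ κ₁ d₁ e₁ ∧ IsSignedAut H π₂ κ₂ d₂ e₂ ∧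
        Commute π₁ π ∧ Commute κ₁ κ ∧ Commute π₂ π ∧ Commute κ₂ κ ∧ π₁ ^ 2 = 1 ∧ κ₁ ^ 2 = 1 ∧ π₂ ^ 2 = 1 ∧ κ₂ ^ 2 = 1 ∧
        (π₁ ≠ 1 ∨ κ₁ ≠ 1) ∧ (π₂ ≠ 1 ∨ κ₂ ≠ 1) ∧ (π₁ ≠ π₂ ∨ κ₁ ≠ κ₂) ∧ IsSignedAut H π' κ' d' e' ∧
        π' * π = π ^ μ * π' ∧ κ' * κ = κ ^ μ * κ' ∧ μ % 167 = 166) :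
    ∃ (ι : Type) (_ : Fintype ι) (_ : DecidableEq ι) (H : Matrix ι ι ℤ) (π κ π' κ' : Equiv.Perm ι)
        (d e d' e' : ι → ℤ) (ν : ℕ) (x₀ : ι), Fintype.card ι = 668 ∧ IsHadamardMatrix H ∧ IsSignedAut H π κ d e ∧
        orderOf ((π, κ) : Equiv.Perm ι × Equiv.Perm ι) = 334 ∧ IsSignedAut H π' κ' d' e' ∧
        π' * π = π ^ ν * π' ∧ κ' * κ = κ ^ ν * κ' ∧ ν % 334 = 333 ∧ π' x₀ = x₀ := by
  obtain ⟨ι, _, _, H, π, κ, π₁, κ₁, π₂, κ₂, π', κ', d, e, d₁, e₁, d₂, e₂, d', e', μ, hι, hH, haut, hπ, hκ, hne, h₁, h₂,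
    hc₁, hc₁', hc₂, hc₂', hi₁, hi₁', hi₂, hi₂', hne₁, hne₂, hne₁₂, haut', hnπ, hnκ, hμ⟩ := hyp
  -- a row-fixing inverting translate
  obtain ⟨g, ⟨D, E, haut''⟩, hnπ'', hnκ'', -, -, -, -, hcard, -⟩ := exists_blockPreserving_inverting hH hι haut hπ hκ hne h₁ h₂
    hc₁ hc₁' hc₂ hc₂' hi₁ hi₁' hi₂ hi₂' hne₁ hne₂ hne₁₂ haut' hnπ hnκ hμ
  set P := π₁ ^ g.1.val * π₂ ^ g.2.val * π' with hP
  set K := κ₁ ^ g.1.val * κ₂ ^ g.2.val * κ' with hK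
  obtain ⟨x₀, hx₀⟩ : (univ.filter fun x => P x = x).Nonempty := by
    rw [← Finset.card_pos, hcard]; norm_num
  have hfix : P x₀ = x₀ := (Finset.mem_filter.mp hx₀).2
  -- it commutes with `τ₁`
  obtain ⟨hcP, hcK⟩ := hadamard668_order167_inverting_commute_involution hH hι haut hπ hκ hne haut'' hnπ'' hnκ'' hμ h₁ hc₁
    hc₁' hi₁ hi₁'
  -- the exponents: `π^μ = π^166 = π^333`, `π₁^333 = π₁`
  have hπμ : π ^ μ = π ^ 333 := by
    rw [← pow_mod_of_pow_eq_one π hπ μ, hμ, ← pow_mod_of_pow_eq_one π hπ 333]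
  have hκμ : κ ^ μ = κ ^ 333 := by
    rw [← pow_mod_of_pow_eq_one κ hκ μ, hμ, ← pow_mod_of_pow_eq_one κ hκ 333]
  have hπ₁ : π₁ ^ 333 = π₁ := by rw [show (333 : ℕ) = 2 * 166 + 1 by norm_num, pow_add, pow_mul, hi₁, one_pow, one_mul, pow_one]
  have hκ₁ : κ₁ ^ 333 = κ₁ := by rw [show (333 : ℕ) = 2 * 166 + 1 by norm_num, pow_add, pow_mul, hi₁', one_pow, one_mul, pow_one]
  have hrelπ : P * (π₁ * π) = (π₁ * π) ^ 333 * P := by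
    rw [← mul_assoc, hcP.eq, mul_assoc, hnπ'', ← mul_assoc, hc₁.mul_pow, hπ₁, hπμ]
  have hrelκ : K * (κ₁ * κ) = (κ₁ * κ) ^ 333 * K := by
    rw [← mul_assoc, hcK.eq, mul_assoc, hnκ'', ← mul_assoc, hc₁'.mul_pow, hκ₁, hκμ]
  exact ⟨ι, inferInstance, inferInstance, H, π₁ * π, κ₁ * κ, P, K, _, _, D, E, 333, x₀, hι, hH, isSignedAut_mul h₁ haut,
    centralizer167_involution_mul_orderOf hπ hκ hne hc₁ hc₁' hi₁ hi₁' hne₁, haut'', hrelπ, hrelκ, by norm_num, hfix⟩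

/-- **KERNEL IFF.**  (∃ H(668) with a signed automorphism of pair order `334` inverted by an automorphism FIXING A ROW) ⇔
(∃ Williamson sequences of length `167`) — hence ⇔ gen 22's `|N(⟨σ₁₆₇⟩):±⟨σ₁₆₇⟩| = 8` ⇔ a classical Williamson matrix of
order `668` (`WilliamsonSequences167Iff668`). -/
theorem hadamard668_order334_inverting_fixed_iff_williamsonSequences :
    (∃ (ι : Type) (_ : Fintype ι) (_ : DecidableEq ι) (H : Matrix ι ι ℤ) (π κ π' κ' : Equiv.Perm ι)
        (d e d' e' : ι → ℤ) (ν : ℕ) (x₀ : ι), Fintype.card ι = 668 ∧ IsHadamardMatrix H ∧ IsSignedAut H π κ d e ∧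
        orderOf ((π, κ) : Equiv.Perm ι × Equiv.Perm ι) = 334 ∧ IsSignedAut H π' κ' d' e' ∧
        π' * π = π ^ ν * π' ∧ κ' * κ = κ ^ ν * κ' ∧ ν % 334 = 333 ∧ π' x₀ = x₀) ↔
    ∃ a b c d : ZMod 167 → ℤ, IsPM a ∧ IsPM b ∧ IsPM c ∧ IsPM d ∧ (∀ i, a (-i) = a i) ∧ (∀ i, b (-i) = b i) ∧
      (∀ i, c (-i) = c i) ∧ (∀ i, d (-i) = d i) ∧
      ∀ s : ZMod 167, s ≠ 0 → PAF a s + PAF b s + PAF c s + PAF d s = 0 :=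
  ⟨hadamard668_order334_inverting_fixed_williamson, fun hW => hadamard668_normalizer_index_eight_order334_inverting_fixed
    (hadamard668_normalizer_index_eight_iff_williamsonSequences.mpr hW)⟩

end Summit.Ventures.DiscreteObjects.Hadamard
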